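import Mathlib.Analysis.Calculus.MeanValue
import Mathlib.Topology.MetricSpace.HausdorffDistance
import Mathlib.Topology.UniformSpace.HeineCantor
import HarnessLib

/-!
# Lyapunov's direct method along a solution curve: sublevel trapping and decay of the dissipation rate

Venture GRIDFUSION (LADDER-GRIDFUSION G3.lyap → G1.<system>-roa), `plan/PARTITION.md` §0 row
`Lyapunov/` + A5 (seat gridfusion-lyap-1); namespace `Summit.Ventures.GridStability.Lyapunov`.
HONEST FRAMING: pure analysis — nothing here mentions a grid, a machine or a certificate; the
CERTIFIED / MODELLED columns enter only in `CertificateSoundness.lean`, which packages these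
theorems in the vocabulary of the Bench certificates. Everything is PROVED (no definition, no named
fact, standard axioms). Companion to the tree's general theorem
`Literature/Analysis/ODE/LyapunovSublevelInvariance.lean` (positive invariance in the open-set
form "`V̇ ≤ 0` on an open `G ⊇ S`", global existence, attraction to a strict minimum `x₀` of `V`,
Fréchet-derivative hypotheses, within-`Icc` solutions), which it complements in the two directions
the certificate bridge needs:

* **curve form.** The hypotheses bear on the real function `V ∘ x` along ONE solution `x`
  (a right derivative `HasDerivWithinAt (V ∘ x) (LV (x t)) (Ici t) t`, with `LV : E → ℝ` any
  function standing for the Lie derivative `∇V · F` — for a polynomial certificate, the polynomial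
  `V̇` the certificate bounds), and on `x` in Mathlib's ODE convention (`ContinuousOn x (Icc a b)`,
  right derivative `F (x t)` at `t ∈ Ico a b`, as in `ODE_solution_unique`, `gronwall`); no Fréchet
  derivative of `V` on `E` is needed, so instantiating on `ℝⁿ` costs one application of the
  one-variable chain rule per coordinate. `solution_Icc_right_deriv` / `solution_Ici_right_deriv`
  convert from the tree's within-`Icc` convention (`GlobalExistence.lean`).
* **attraction to a set.** With a dissipation inequality `LV ≤ -W`, `W ≥ 0` continuous on a
  compact `K` containing the forward orbit, `W (x t) → 0` (`tendsto_dissipation_zero`) and the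
  distance from `x t` to the zero set `{y ∈ K | W y = 0}` tends to `0`
  (`tendsto_infDist_dissipation_zero`) — the LaSalle-type conclusion "trajectories approach the set
  where the dissipation vanishes" (e.g. the equilibrium set), obtained WITHOUT limit sets, flows or
  uniqueness, by the argument of Rouche–Habets–Laloy 1977, Ch. I §6, proof of Thm. 6.2 (a)
  ("`V(t,x(t)) ≤ V(t₀,x₀) - ∫ c(‖x(s)‖) ds ≤ b(α) - c(η)σ < 0`, which contradicts (i)") run with
  Heine–Cantor and the speed bound `‖x s - x t‖ ≤ B |s - t|` in place of the integral;
  `tendsto_of_dissipation` is the case `{W = 0} ∩ K = {x₀}`.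

Also here, for the invariance step in the "strict on the level surface" form that a
sum-of-squares Lyapunov certificate delivers (`-V̇ - W - λ (c - V) ∈ Σ …`, `W > 0` on `{V = c}`):

* `forall_mem_sublevel_of_eventually` — the **continuous-induction core** (Mathlib's
  `IsClosed.Icc_subset_of_forall_mem_nhdsWithin`): a continuous curve starting in the closed piece
  `S = {y ∈ D | V y ≤ c}` stays in `S` on `[a, b]` provided, whenever `x t ∈ S`, it stays in `D`
  and below the level `c` for a short while after `t`;
* `forall_mem_sublevel_of_deriv_neg` — the **strict form**: the second proviso from a right
  derivative of `V ∘ x` that is `< 0` when `V (x t) = c` (`HasDerivWithinAt.limsup_slope_le'`);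
  the first proviso ("fencing") is discharged by `eventually_mem_of_subset_interior`
  (`S ⊆ interior D`), `eventually_mem_of_forall_mem` (the curve is known to stay in `D`, e.g. `D`
  a first-integral level set `{h = 0}` of a polynomial recast) or
  `eventually_mem_inter_of_forall_mem_of_subset_interior` (both: `D = M ∩ D'`);
* `le_add_mul_of_deriv_right_le`, `antitoneOn_of_deriv_right_nonpos` — affine comparison /
  monotonicity for a real function with bounded right derivative
  (`image_le_of_deriv_right_le_deriv_boundary`).

WHY "strict" (or "open"): with `V̇ ≤ 0` assumed on `S` only, invariance fails — `x' = 1` on `ℝ`,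
`V x = (x² - 1)²`, `c = 0`, `S = {-1, 1}`, `V̇ = 0` on `S`, and `x t = 1 + t` leaves `S`
(Vidyasagar 1978 §5.2.2 Lemma (81) asserts it as "clearly"; RHL use the inequality on an open set).

## References

* N. Rouche, P. Habets, M. Laloy, *Stability Theory by Liapunov's Direct Method*, Applied
  Mathematical Sciences 22, Springer 1977, Ch. I §6, Theorem 6.2 (A. M. Liapunov 1892) and its
  proof. [RoucheHabetsLaloy1977]
* M. Vidyasagar, *Nonlinear Systems Analysis*, Prentice-Hall 1978, §5.2.2, Lemma (81). [Vidyasagar1978]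

Not here: existence of solutions (`LyapunovSublevelInvariance.lean`); LaSalle's invariance
principle proper (largest invariant subset of `{V̇ = 0}`); non-autonomous fields.
-/

noncomputable section

open Set Filter Metric Topology

namespace Summit.Ventures.GridStability.Lyapunov

/-! ### The continuous-induction core -/

section Core

variable {X : Type*} [TopologicalSpace X]

/-- **Sublevel trapping, continuous-induction form.** Let `x : ℝ → X` be continuous on `[a, b]`
with `x a ∈ S := {y ∈ D | V y ≤ c}`, `S` closed. Suppose that at every time `t ∈ [a, b)` at which
`x t ∈ S`, the point `x s` stays in `D` for all `s` slightly larger than `t`, and `V (x s) ≤ c`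
for all `s` slightly larger than `t`. Then `x t ∈ S` for all `t ∈ [a, b]` ("induction on a real
interval": the set of good times is closed, contains `a`, and is right-open;
Mathlib's `IsClosed.Icc_subset_of_forall_mem_nhdsWithin`). [folklore] -/
theorem forall_mem_sublevel_of_eventually {D : Set X} {V : X → ℝ} {c : ℝ} {x : ℝ → X}
    {a b : ℝ} (hS : IsClosed {y ∈ D | V y ≤ c}) (hx : ContinuousOn x (Icc a b))
    (ha : x a ∈ D) (hac : V (x a) ≤ c)
    (hD : ∀ t ∈ Ico a b, x t ∈ D → V (x t) ≤ c → ∀ᶠ s in 𝓝[>] t, x s ∈ D)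
    (hV : ∀ t ∈ Ico a b, x t ∈ D → V (x t) ≤ c → ∀ᶠ s in 𝓝[>] t, V (x s) ≤ c) :
    ∀ t ∈ Icc a b, x t ∈ D ∧ V (x t) ≤ c := by
  set S : Set X := {y ∈ D | V y ≤ c} with hSdef
  set s : Set ℝ := Icc a b ∩ x ⁻¹' S with hsdef
  have hs_closed : IsClosed (s ∩ Icc a b) := by
    rw [inter_eq_left.2 inter_subset_left]
    exact hx.preimage_isClosed_of_isClosed isClosed_Icc hS
  intro t ht
  have hab : a ≤ b := ht.1.trans ht.2
  have has : a ∈ s := ⟨left_mem_Icc.2 hab, ha, hac⟩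
  have key : Icc a b ⊆ s := by
    refine hs_closed.Icc_subset_of_forall_mem_nhdsWithin has ?_
    rintro u ⟨⟨-, huD, huV⟩, hu⟩
    have h1 : Icc a b ∈ 𝓝[>] u := Icc_mem_nhdsGT_of_mem hu
    have h2 := hD u hu huD huV
    have h3 := hV u hu huD huV
    filter_upwards [h1, h2, h3] with w hw1 hw2 hw3
    exact ⟨hw1, hw2, hw3⟩
  exact (key ht).2

/-- **Sublevel trapping, strict form along a curve.** As `forall_mem_sublevel_of_eventually`,
with the sublevel persistence supplied by one-sided derivatives of `V ∘ x`: whenever `x t ∈ S`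
the function `V ∘ x` has a right derivative at `t`, which is `< 0` if `V (x t) = c`. (If
`V (x t) < c` right-continuity keeps `V ∘ x` below `c`; if `V (x t) = c` the negative right
derivative does, `HasDerivWithinAt.limsup_slope_le'`.) [folklore] -/
theorem forall_mem_sublevel_of_deriv_neg {D : Set X} {V : X → ℝ} {c : ℝ} {x : ℝ → X}
    {a b : ℝ} (hS : IsClosed {y ∈ D | V y ≤ c}) (hx : ContinuousOn x (Icc a b))
    (ha : x a ∈ D) (hac : V (x a) ≤ c)
    (hD : ∀ t ∈ Ico a b, x t ∈ D → V (x t) ≤ c → ∀ᶠ s in 𝓝[>] t, x s ∈ D)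
    (hderiv : ∀ t ∈ Ico a b, x t ∈ D → V (x t) ≤ c →
      ∃ φ' : ℝ, HasDerivWithinAt (V ∘ x) φ' (Ici t) t ∧ (V (x t) = c → φ' < 0)) :
    ∀ t ∈ Icc a b, x t ∈ D ∧ V (x t) ≤ c := by
  refine forall_mem_sublevel_of_eventually hS hx ha hac hD fun t ht htD htV ↦ ?_
  obtain ⟨φ', hφ, hneg⟩ := hderiv t ht htD htV
  rcases htV.lt_or_eq with hlt | heq
  · -- `V (x t) < c`: right-continuity of `V ∘ x` at `t`
    have h1 : ∀ᶠ s in 𝓝[Ici t] t, (V ∘ x) s < c :=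
      hφ.continuousWithinAt.tendsto.eventually_lt_const hlt
    filter_upwards [h1.filter_mono (nhdsWithin_mono t Ioi_subset_Ici_self)] with s hs
    exact hs.le
  · -- `V (x t) = c`: negative right derivative
    have h1 : ∀ᶠ z in 𝓝[>] t, slope (V ∘ x) t z < 0 :=
      hφ.Ioi_of_Ici.limsup_slope_le' (fun h ↦ lt_irrefl t h) (hneg heq)
    filter_upwards [h1, self_mem_nhdsWithin] with z hz hzt
    have hzpos : 0 < z - t := sub_pos.2 hzt
    rw [slope_def_field, div_lt_iff₀ hzpos, zero_mul] at hz
    simp only [Function.comp_apply] at hz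
    linarith

/-- The fencing hypothesis `hD` of the invariance theorems from **`S ⊆ interior D`**: a continuous
curve that is in `S` at time `t` is in `D` shortly after. [folklore] -/
theorem eventually_mem_of_subset_interior {D S : Set X} {x : ℝ → X} {a b t : ℝ}
    (hSD : S ⊆ interior D) (hx : ContinuousOn x (Icc a b)) (ht : t ∈ Ico a b) (hxt : x t ∈ S) :
    ∀ᶠ s in 𝓝[>] t, x s ∈ D := by
  have h1 : x ⁻¹' D ∈ 𝓝[Icc a b] t :=
    (hx t (Ico_subset_Icc_self ht)).preimage_mem_nhdsWithin
      (mem_interior_iff_mem_nhds.1 (hSD hxt))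
  exact (nhdsWithin_le_of_mem (Icc_mem_nhdsGT_of_mem ht)) h1

/-- The fencing hypothesis `hD` of the invariance theorems for a curve **known to stay in `D`**
(e.g. `D` an invariant constraint set `{h = 0}` of the flow, or `D = univ`). [folklore] -/
theorem eventually_mem_of_forall_mem {Y : Type*} {D : Set Y} {x : ℝ → Y} {a b t : ℝ}
    (hxD : ∀ s ∈ Icc a b, x s ∈ D) (ht : t ∈ Ico a b) : ∀ᶠ s in 𝓝[>] t, x s ∈ D := by
  filter_upwards [Icc_mem_nhdsGT_of_mem ht] with s hs using hxD s hs

/-- The fencing hypothesis `hD` for `D = M ∩ D'` with the curve known to stay in `M` (an invariant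
constraint set) and `S ⊆ interior D'` (the certified piece does not touch the boundary of the
domain `D'`). [folklore] -/
theorem eventually_mem_inter_of_forall_mem_of_subset_interior {M D' S : Set X} {x : ℝ → X}
    {a b t : ℝ} (hxM : ∀ s ∈ Icc a b, x s ∈ M) (hSD : S ⊆ interior D')
    (hx : ContinuousOn x (Icc a b)) (ht : t ∈ Ico a b) (hxt : x t ∈ S) :
    ∀ᶠ s in 𝓝[>] t, x s ∈ M ∩ D' :=
  (eventually_mem_of_forall_mem hxM ht).and (eventually_mem_of_subset_interior hSD hx ht hxt)

end Core

/-! ### Comparison for a real function with a bounded right derivative -/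

section Comparison

/-- **Affine comparison for right derivatives**: if `φ` is continuous on `[a, b]` with right
derivative `φ' t ≤ m` at every `t ∈ [a, b)`, then `φ t ≤ φ a + m (t - a)` on `[a, b]`
(Mathlib's fencing theorem `image_le_of_deriv_right_le_deriv_boundary` with an affine bound).
Used below with `φ = V ∘ x`, the auxiliary function along a solution. [folklore] -/
theorem le_add_mul_of_deriv_right_le {φ φ' : ℝ → ℝ} {a b m : ℝ} (hφ : ContinuousOn φ (Icc a b))
    (hφ' : ∀ t ∈ Ico a b, HasDerivWithinAt φ (φ' t) (Ici t) t) (hm : ∀ t ∈ Ico a b, φ' t ≤ m) :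
    ∀ t ∈ Icc a b, φ t ≤ φ a + m * (t - a) := by
  have hB' : ∀ t ∈ Ico a b, HasDerivWithinAt (fun t ↦ φ a + m * (t - a)) m (Ici t) t := by
    intro t _
    have h := ((hasDerivAt_id t).sub_const a).const_mul m |>.const_add (φ a)
    simpa using h.hasDerivWithinAt
  intro t ht
  exact image_le_of_deriv_right_le_deriv_boundary hφ hφ' (by simp) (by fun_prop) hB' hm ht

/-- **Monotonicity**: a continuous function on `[a, b]` with right derivative `≤ 0` on `[a, b)` is
non-increasing on `[a, b]`. [folklore] -/
theorem antitoneOn_of_deriv_right_nonpos {φ φ' : ℝ → ℝ} {a b : ℝ} (hφ : ContinuousOn φ (Icc a b))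
    (hφ' : ∀ t ∈ Ico a b, HasDerivWithinAt φ (φ' t) (Ici t) t) (h0 : ∀ t ∈ Ico a b, φ' t ≤ 0) :
    AntitoneOn φ (Icc a b) := by
  intro s hs t ht hst
  have hsub : Icc s b ⊆ Icc a b := Icc_subset_Icc_left hs.1
  have h := le_add_mul_of_deriv_right_le (m := 0) (hφ.mono hsub)
    (fun u hu ↦ hφ' u ⟨hs.1.trans hu.1, hu.2⟩) (fun u hu ↦ h0 u ⟨hs.1.trans hu.1, hu.2⟩) t
    ⟨hst, ht.2⟩
  simpa using h

end Comparison

/-! ### Decay of the dissipation rate and convergence to its zero set -/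
section Convergence

variable {E : Type*} [NormedAddCommGroup E] [NormedSpace ℝ E]

/-- **Dissipation rate tends to zero (Lyapunov / Barbashin–Krasovskii argument), curve form.** Let
`x` solve `x' = F x` on `[0, ∞)` (continuous, right derivative `F (x t)` at every `t ≥ 0`) with
values in a compact set `K` on which `F`, `V`, `W` are continuous and `W ≥ 0`; suppose the
auxiliary function `V ∘ x` has right derivative `LV (x t)` at every `t ≥ 0`, where `LV ≤ -W` on
`K` (`LV` = the Lie derivative `∇V · F` of the sources, here any function). Then `W (x t) → 0`.
Proof (Rouche–Habets–Laloy 1977, Ch. I §6, proof of Thm. 6.2 (a), with a general dissipation rate):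
`V ∘ x` is non-increasing and bounded below, so after some `t₀` it stays within `ητ` of its infimum;
if `W (x t) ≥ 2η` at a later `t`, uniform continuity of `W` on `K` (Heine–Cantor) and
`‖x s - x t‖ ≤ B (s - t)` (`‖F‖ ≤ B` on `K`) give `W (x s) ≥ η` on `[t, t + τ]`, `τ = δ/(2B)`,
whence `V (x (t + τ)) ≤ V (x t) - ητ` — a contradiction.
[cite: RoucheHabetsLaloy1977, Ch. I §6 Thm. 6.2] -/
theorem tendsto_dissipation_zero {F : E → E} {V LV W : E → ℝ} {K : Set E} {x : ℝ → E}
    (hK : IsCompact K) (hF : ContinuousOn F K) (hVc : ContinuousOn V K) (hW : ContinuousOn W K)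
    (hW0 : ∀ y ∈ K, 0 ≤ W y) (hLie : ∀ y ∈ K, LV y ≤ -W y)
    (hx : ContinuousOn x (Ici 0)) (hxF : ∀ t, 0 ≤ t → HasDerivWithinAt x (F (x t)) (Ici t) t)
    (hφ : ∀ t, 0 ≤ t → HasDerivWithinAt (V ∘ x) (LV (x t)) (Ici t) t)
    (hxK : ∀ t, 0 ≤ t → x t ∈ K) :
    Tendsto (fun t ↦ W (x t)) atTop (𝓝 0) := by
  -- a bound for the speed
  obtain ⟨B, hB⟩ := hK.exists_bound_of_continuousOn hF
  set B₀ : ℝ := |B| + 1 with hB₀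
  have hB₀pos : 0 < B₀ := by positivity
  have hFB : ∀ y ∈ K, ‖F y‖ ≤ B₀ := fun y hy ↦ (hB y hy).trans ((le_abs_self B).trans (by linarith))
  -- `V` is bounded below on `K`
  have hKne : K.Nonempty := ⟨x 0, hxK 0 le_rfl⟩
  obtain ⟨y₀, hy₀, hmin⟩ := hK.exists_isMinOn hKne hVc
  -- `V ∘ x` is continuous and non-increasing on `[0, ∞)`
  have hVx : ContinuousOn (V ∘ x) (Ici 0) :=
    hVc.comp hx fun t ht ↦ hxK t ht
  have hanti : ∀ s t, 0 ≤ s → s ≤ t → V (x t) ≤ V (x s) := by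
    intro s t hs hst
    have h := antitoneOn_of_deriv_right_nonpos (a := s) (b := t) (hVx.mono fun u hu ↦ hs.trans hu.1)
      (fun u hu ↦ hφ u (hs.trans hu.1))
      (fun u hu ↦ (hLie _ (hxK u (hs.trans hu.1))).trans
        (neg_nonpos.2 (hW0 _ (hxK u (hs.trans hu.1)))))
    exact h ⟨le_rfl, hst⟩ ⟨hst, le_rfl⟩ hst
  -- the infimum `L` of `V ∘ x`
  set A : Set ℝ := (fun t ↦ V (x t)) '' Ici 0 with hA
  have hAne : A.Nonempty := ⟨V (x 0), 0, mem_Ici.2 le_rfl, rfl⟩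
  have hAbdd : BddBelow A := ⟨V y₀, by rintro _ ⟨t, ht, rfl⟩; exact hmin (hxK t ht)⟩
  set L : ℝ := sInf A with hL
  have hLle : ∀ t, 0 ≤ t → L ≤ V (x t) := fun t ht ↦ csInf_le hAbdd ⟨t, ht, rfl⟩
  -- uniform continuity of `W` on `K`
  have hWuc := Metric.uniformContinuousOn_iff.1 (hK.uniformContinuousOn_of_continuous hW)
  rw [Metric.tendsto_atTop]
  intro ε hε
  set η : ℝ := ε / 2 with hη
  have hηpos : 0 < η := by positivity
  obtain ⟨δ, hδ, hWδ⟩ := hWuc η hηpos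
  set τ : ℝ := δ / (2 * B₀) with hτ
  have hτpos : 0 < τ := by positivity
  have hB₀τ : B₀ * τ = δ / 2 := by rw [hτ]; field_simp
  -- a time after which `V ∘ x` is within `η τ` of its infimum
  obtain ⟨_, ⟨t₀, ht₀, rfl⟩, hVt₀⟩ := exists_lt_of_csInf_lt hAne (show sInf A < L + η * τ by
    rw [hL]; linarith [mul_pos hηpos hτpos])
  refine ⟨t₀, fun t ht ↦ ?_⟩
  have ht0 : 0 ≤ t := le_trans ht₀ ht
  rw [Real.dist_eq, sub_zero, abs_of_nonneg (hW0 _ (hxK t ht0))]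
  by_contra hcon
  rw [not_lt] at hcon
  -- on `[t, t + τ]` the curve stays `δ`-close to `x t`, so `W ∘ x ≥ η` there
  have hxc : ContinuousOn x (Icc t (t + τ)) := hx.mono fun s hs ↦ ht0.trans hs.1
  have hclose : ∀ s ∈ Icc t (t + τ), ‖x s - x t‖ ≤ B₀ * (s - t) :=
    norm_image_sub_le_of_norm_deriv_right_le_segment hxc (fun s hs ↦ hxF s (ht0.trans hs.1))
      fun s hs ↦ hFB _ (hxK s (ht0.trans hs.1))
  have hWη : ∀ s ∈ Ico t (t + τ), η ≤ W (x s) := by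
    intro s hs
    have hsK : x s ∈ K := hxK s (ht0.trans hs.1)
    have hdist : dist (x s) (x t) < δ := by
      rw [dist_eq_norm]
      refine (hclose s (Ico_subset_Icc_self hs)).trans_lt ?_
      calc B₀ * (s - t) ≤ B₀ * τ := by gcongr; linarith [hs.2]
        _ = δ / 2 := hB₀τ
        _ < δ := by linarith
    have h := hWδ (x s) hsK (x t) (hxK t ht0) hdist
    rw [Real.dist_eq, abs_lt] at h
    linarith [h.1]
  -- hence `V` drops by at least `η τ` on `[t, t + τ]`
  have hdrop := le_add_mul_of_deriv_right_le (m := -η) (hVx.mono fun s hs ↦ ht0.trans hs.1)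
    (fun s hs ↦ hφ s (ht0.trans hs.1))
    (fun s hs ↦ (hLie _ (hxK s (ht0.trans hs.1))).trans (by linarith [hWη s hs])) (t + τ)
    ⟨by linarith, le_rfl⟩
  have h1 : V (x t) ≤ V (x t₀) := hanti t₀ t ht₀ ht
  have h2 : L ≤ V (x (t + τ)) := hLle (t + τ) (by linarith)
  simp only [Function.comp_apply] at hdrop
  linarith

/-- **Convergence to the zero set of the dissipation rate.** Under the hypotheses of
`tendsto_dissipation_zero`, the distance from `x t` to `Z := {y ∈ K | W y = 0}` tends to `0`:
for `ε > 0` the set `K ∩ {infDist · Z ≥ ε}` is compact and `W > 0` on it, hence `W ≥ m > 0`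
there, while `W (x t) < m` for large `t`. (Autonomous case of Rouche–Habets–Laloy 1977, Ch. I §6
Thm. 6.2 (a), with a general dissipation rate `W` in place of `c(‖x‖)`: attraction to the SET
where the dissipation vanishes, e.g. the equilibrium set; for `Z = {x₀}` see
`tendsto_of_dissipation`.) [cite: RoucheHabetsLaloy1977, Ch. I §6 Thm. 6.2] -/
theorem tendsto_infDist_dissipation_zero {F : E → E} {V LV W : E → ℝ} {K : Set E} {x : ℝ → E}
    (hK : IsCompact K) (hF : ContinuousOn F K) (hVc : ContinuousOn V K) (hW : ContinuousOn W K)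
    (hW0 : ∀ y ∈ K, 0 ≤ W y) (hLie : ∀ y ∈ K, LV y ≤ -W y)
    (hx : ContinuousOn x (Ici 0)) (hxF : ∀ t, 0 ≤ t → HasDerivWithinAt x (F (x t)) (Ici t) t)
    (hφ : ∀ t, 0 ≤ t → HasDerivWithinAt (V ∘ x) (LV (x t)) (Ici t) t)
    (hxK : ∀ t, 0 ≤ t → x t ∈ K) :
    Tendsto (fun t ↦ infDist (x t) {y ∈ K | W y = 0}) atTop (𝓝 0) := by
  set Z : Set E := {y ∈ K | W y = 0} with hZ
  have hWt := tendsto_dissipation_zero hK hF hVc hW hW0 hLie hx hxF hφ hxK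
  rw [Metric.tendsto_atTop] at hWt ⊢
  intro ε hε
  set Kε : Set E := K ∩ {y | ε ≤ infDist y Z} with hKε
  have hKεc : IsCompact Kε :=
    hK.inter_right (isClosed_le continuous_const (continuous_infDist_pt Z))
  rcases Kε.eq_empty_or_nonempty with hempty | hne
  · -- no point of `K` is `ε`-far from `Z`
    refine ⟨0, fun t ht ↦ ?_⟩
    rw [Real.dist_eq, sub_zero, abs_of_nonneg infDist_nonneg]
    by_contra hcon
    rw [not_lt] at hcon
    have : x t ∈ Kε := ⟨hxK t ht, hcon⟩
    rw [hempty] at this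
    exact this
  · obtain ⟨y₀, hy₀, hmin⟩ := hKεc.exists_isMinOn hne (hW.mono inter_subset_left)
    have hWy₀ : 0 < W y₀ := by
      rcases (hW0 y₀ hy₀.1).lt_or_eq with h | h
      · exact h
      · exfalso
        have hyZ : y₀ ∈ Z := ⟨hy₀.1, h.symm⟩
        have h0 : infDist y₀ Z = 0 := infDist_zero_of_mem hyZ
        have := hy₀.2
        rw [mem_setOf_eq, h0] at this
        linarith
    obtain ⟨N, hN⟩ := hWt (W y₀) hWy₀
    refine ⟨max N 0, fun t ht ↦ ?_⟩
    have ht0 : 0 ≤ t := (le_max_right _ _).trans ht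
    have hNt : N ≤ t := (le_max_left _ _).trans ht
    rw [Real.dist_eq, sub_zero, abs_of_nonneg infDist_nonneg]
    by_contra hcon
    rw [not_lt] at hcon
    have hmem : x t ∈ Kε := ⟨hxK t ht0, hcon⟩
    have h1 : W y₀ ≤ W (x t) := hmin hmem
    have h2 := hN t hNt
    rw [Real.dist_eq, sub_zero, abs_of_nonneg (hW0 _ (hxK t ht0))] at h2
    linarith

/-- **Convergence to the equilibrium.** If, in `tendsto_infDist_dissipation_zero`, the
dissipation rate vanishes on `K` only at `x₀ ∈ K`, then `x t → x₀`.
[cite: RoucheHabetsLaloy1977, Ch. I §6 Thm. 6.2] -/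
theorem tendsto_of_dissipation {F : E → E} {V LV W : E → ℝ} {K : Set E} {x : ℝ → E} {x₀ : E}
    (hK : IsCompact K) (hF : ContinuousOn F K) (hVc : ContinuousOn V K) (hW : ContinuousOn W K)
    (hW0 : ∀ y ∈ K, 0 ≤ W y) (hLie : ∀ y ∈ K, LV y ≤ -W y) (hx₀ : x₀ ∈ K)
    (hZ : ∀ y ∈ K, W y = 0 → y = x₀) (hWx₀ : W x₀ = 0)
    (hx : ContinuousOn x (Ici 0)) (hxF : ∀ t, 0 ≤ t → HasDerivWithinAt x (F (x t)) (Ici t) t)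
    (hφ : ∀ t, 0 ≤ t → HasDerivWithinAt (V ∘ x) (LV (x t)) (Ici t) t)
    (hxK : ∀ t, 0 ≤ t → x t ∈ K) : Tendsto x atTop (𝓝 x₀) := by
  have h := tendsto_infDist_dissipation_zero hK hF hVc hW hW0 hLie hx hxF hφ hxK
  have hZeq : {y ∈ K | W y = 0} = {x₀} := by
    ext y
    simp only [mem_setOf_eq, mem_singleton_iff]
    exact ⟨fun hy ↦ hZ y hy.1 hy.2, fun hy ↦ hy ▸ ⟨hx₀, hWx₀⟩⟩
  rw [hZeq] at h
  simp only [infDist_singleton] at h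
  exact tendsto_iff_dist_tendsto_zero.2 h

end Convergence

/-! ### Solution conventions -/

section Conventions

variable {E : Type*} [NormedAddCommGroup E] [NormedSpace ℝ E]

/-- From the tree's closed-interval solution convention
(`∀ t ∈ Icc a b, HasDerivWithinAt x (F (x t)) (Icc a b) t`, i.e. Mathlib's `IsIntegralCurveOn`
unfolded) to the hypotheses used in this file: continuity on `[a, b]` and a right derivative at
every `t ∈ [a, b)`. [folklore] -/
theorem solution_Icc_right_deriv {F : E → E} {x : ℝ → E} {a b : ℝ}
    (h : ∀ t ∈ Icc a b, HasDerivWithinAt x (F (x t)) (Icc a b) t) :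
    ContinuousOn x (Icc a b) ∧ ∀ t ∈ Ico a b, HasDerivWithinAt x (F (x t)) (Ici t) t :=
  ⟨fun t ht ↦ (h t ht).continuousWithinAt,
    fun t ht ↦ (h t (Ico_subset_Icc_self ht)).mono_of_mem_nhdsWithin (Icc_mem_nhdsGE_of_mem ht)⟩

/-- From a solution on every `[0, T]` in the tree's convention (the output of
`exists_solution_of_apriori_bound`) to the `[0, ∞)` hypotheses used in this file. [folklore] -/
theorem solution_Ici_right_deriv {F : E → E} {x : ℝ → E}
    (h : ∀ T : ℝ, ∀ t ∈ Icc 0 T, HasDerivWithinAt x (F (x t)) (Icc 0 T) t) :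
    ContinuousOn x (Ici 0) ∧ ∀ t, 0 ≤ t → HasDerivWithinAt x (F (x t)) (Ici t) t := by
  have hmem : ∀ t : ℝ, 0 ≤ t → Icc 0 (t + 1) ∈ 𝓝[Ici 0] t := fun t _ ↦
    mem_of_superset (inter_mem_nhdsWithin (Ici (0 : ℝ)) (Iio_mem_nhds (by linarith)))
      fun s hs ↦ ⟨hs.1, hs.2.le⟩
  refine ⟨fun t ht ↦ ?_, fun t ht ↦ ?_⟩
  · exact ((h (t + 1)) t ⟨ht, by linarith⟩).continuousWithinAt.mono_of_mem_nhdsWithin (hmem t ht)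
  · exact ((h (t + 1)) t ⟨ht, by linarith⟩).mono_of_mem_nhdsWithin
      (Icc_mem_nhdsGE_of_mem ⟨ht, by linarith⟩)

end Conventions

end Summit.Ventures.GridStability.Lyapunov

end
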